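import Literature.MathematicalPhysics.QuantumLattice.HartreeFockUpperBound
import Literature.MathematicalPhysics.QuantumLattice.HubbardLangerMattisTorus
import HarnessLib

/-!
# The antiferromagnetic (spin-density-wave) Hartree–Fock state on the even torus

Topic `MathematicalPhysics/QuantumLattice`, family `hubbard`; continuation of
`HartreeFockUpperBound.lean` (`HartreeFock.groundEnergyAt_le_hfEnergy`: `E₀(N) ≤ re E_HF(P)` for
every orthogonal projection `P` with `tr P = N`, Bach–Lieb–Solovej 1994 (2c.36)) and of
`HubbardLangerMattisTorus.lean` (the site plane waves `W` diagonalising the torus hopping matrix,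
`LangerMattis.hopMatrix_torus_eq_conj`). We construct the classical **spin-density-wave
(antiferromagnetic Hartree–Fock) Slater projection** on the discrete torus `(ℤ/Lℤ)^d`, `L` even,
at half filling — the state behind the Langer–Mattis / Penn UPPER curve `E_A(U, x)`
(Langer–Mattis, Phys. Lett. 36A (1971) 139, eqs. (2)–(4); Penn, Phys. Rev. 142 (1966) 350) —
and evaluate its Hartree–Fock energy in closed momentum-sum form:

* `conjDiag f = W diag(f) Wᴴ` (functions of the torus hopping matrix) with its algebra
  (`conjDiag_mul`, `trace_conjDiag`, `conjDiag_apply_self` — translation invariance: the diagonal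
  of `W diag(f) Wᴴ` is the constant `L^{-d} Σ_k f(k)`), the staggering matrix
  `stagMatrix = diag((-1)^{Σxᵢ})` with `K S = -S K` on the even torus (`hopMatrix_mul_stagMatrix`);
* `sdwR = W diag(1/E_k) Wᴴ`, `E_k = √(ε_k² + Δ²)`: `R² (K² + Δ²) = 1`, `R ≥ 0`, and
  `S R S = R` (`stagMatrix_mul_sdwR_mul_stagMatrix`, by UNIQUENESS OF THE POSITIVE SQUARE ROOT,
  Mathlib `CFC.sqrt_unique` — no momentum-shift bookkeeping);
* the SDW one-body Hamiltonians `h_± = K ± Δ S`, `h_±² = K² + Δ²`, and the band projections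
  `sdwProj s = ½(1 - h_s R)`: Hermitian idempotents (`sdwProj_mul_self`) with
  `tr P_+ + tr P_- = L^d` and diagonal `P_s(x,x) = ½(1 - sΔ(-1)^x r)`, `r = L^{-d}Σ_k 1/E_k`;
* the spin-block lift `spinBlock` to the orbital space `Orb Λ = Λ × {↑,↓}` and the evaluation
  `hfEnergy (spinBlock P_±) = -Σ_k ε_k²/E_k + (U/4)(L^d - Δ² (Σ_k 1/E_k)²/L^d)`
  (`hfEnergy_sdw`);
* **`hubbardTorus_groundEnergyAt_le_sdw`**: for `L` even, `L ≥ 3`, all real `t, U` and `Δ ≠ 0`,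
  `E_L(L^d) ≤ -Σ_k (2tΣᵢcos(2πkᵢ/L))²/E_k + (U/4)(L^d - Δ²(Σ_k E_k⁻¹)²/L^d)`,
  `E_k = √((2tΣᵢcos)² + Δ²)` — the finite-volume antiferromagnetic Hartree–Fock upper bound
  (at the self-consistent `Δ` this is Langer–Mattis' `E_A(U, x*)·L^d`, eq. (4) of loc. cit.).

Everything is proved; definitions have bodies; no named facts.

## Mathlib / tree search

Tree (REUSED): `LangerMattis.sitePlaneWave`, `sitePlaneWave_mul_conjTranspose`,
`conjTranspose_sitePlaneWave_mul`, `LangerMattis.siteBand`, `LangerMattis.hopMatrix_torus_eq_conj`,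
`LangerMattis.hopMatrix`, `torusStagger`, `torusStagger_eq_neg_of_adj_holds`, `torusFourierWeight`,
`torusFourierWeight_mul_self`, `torusChar_mul_conj`, `FermionTorus.sum_eq_sum_torusSite`,
`sum_orb_eq_sum_sum`, `LangerMattis.card_fermionTorus_eq`, `HartreeFock.groundEnergyAt_le_hfEnergy`.
Mathlib: `Matrix.posSemidef_diagonal_iff`, `Matrix.PosSemidef.mul_mul_conjTranspose_same`,
`CFC.sqrt_unique` (with `open scoped MatrixOrder`), `Matrix.inv_eq_left_inv`, `Matrix.trace_mul_cycle`.
`lean search 'spinDensityWave|sdwProj|antiferromagnetic Hartree'`: nothing in Mathlib or the tree.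

## References

* J. S. Langer, D. C. Mattis, Phys. Lett. 36A (1971) 139, eqs. (2)–(4) (the two-sublattice
  Hartree–Fock state and its energy `E_A(U, x)`). [LangerMattis1971]
* D. R. Penn, Phys. Rev. 142 (1966) 350 (antiferromagnetic Hartree–Fock of the Hubbard model). [folklore]
* V. Bach, E. H. Lieb, J. P. Solovej, J. Stat. Phys. 76 (1994) 3, eq. (2c.36). [BachLiebSolovej1994]
-/

noncomputable section

namespace Literature.MathematicalPhysics.QuantumLattice

namespace HartreeFock

open Matrix Finset Literature.Probability.LatticeModels
  Literature.MathematicalPhysics.QuantumLattice.LangerMattis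
open scoped ComplexConjugate ComplexOrder MatrixOrder

variable {d L : ℕ}

/-! ### Functions of the torus hopping matrix: `W diag(f) Wᴴ` -/

section ConjDiag

variable [NeZero L]

variable (d L) in
/-- `conjDiag f = W diag(f) Wᴴ`, `W` the site plane-wave matrix of the torus: the
translation-invariant matrix with symbol `f`. [cite: FriedliVelenikSMLS2017, §10.5.2] -/
def conjDiag (f : FermionTorus d L → ℂ) : Matrix (FermionTorus d L) (FermionTorus d L) ℂ :=
  sitePlaneWave d L * diagonal f * (sitePlaneWave d L)ᴴ

/-- `conjDiag f · conjDiag g = conjDiag (f g)`. [folklore] -/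
theorem conjDiag_mul (f g : FermionTorus d L → ℂ) :
    conjDiag d L f * conjDiag d L g = conjDiag d L (f * g) := by
  simp only [conjDiag, Matrix.mul_assoc]
  rw [← Matrix.mul_assoc (sitePlaneWave d L)ᴴ, conjTranspose_sitePlaneWave_mul, Matrix.one_mul,
    ← Matrix.mul_assoc (diagonal f), diagonal_mul_diagonal]
  rfl

/-- `conjDiag 1 = 1`. [folklore] -/
theorem conjDiag_one : conjDiag d L (fun _ => 1) = 1 := by
  rw [conjDiag, diagonal_one, Matrix.mul_one, sitePlaneWave_mul_conjTranspose]

/-- `conjDiag` is additive. [folklore] -/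
theorem conjDiag_add (f g : FermionTorus d L → ℂ) :
    conjDiag d L (f + g) = conjDiag d L f + conjDiag d L g := by
  rw [conjDiag, conjDiag, conjDiag, show diagonal (f + g) = diagonal f + diagonal g from
    (diagonal_add f g).symm, Matrix.mul_add, Matrix.add_mul]

/-- `conjDiag (c · 1) = c • 1`. [folklore] -/
theorem conjDiag_const (c : ℂ) : conjDiag d L (fun _ => c) = c • (1 : Matrix _ _ ℂ) := by
  have h : (fun _ : FermionTorus d L => c) = c • (fun _ => (1 : ℂ)) := by
    funext k; simp
  rw [h, conjDiag, diagonal_smul, Matrix.mul_smul, Matrix.smul_mul, ← conjDiag, conjDiag_one]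

/-- `(conjDiag f)ᴴ = conjDiag (conj f)`. [folklore] -/
theorem conjTranspose_conjDiag (f : FermionTorus d L → ℂ) :
    (conjDiag d L f)ᴴ = conjDiag d L (star f) := by
  rw [conjDiag, conjDiag, conjTranspose_mul, conjTranspose_mul, conjTranspose_conjTranspose,
    diagonal_conjTranspose, Matrix.mul_assoc]

/-- `tr (conjDiag f) = Σ_k f(k)`. [folklore] -/
theorem trace_conjDiag (f : FermionTorus d L → ℂ) : (conjDiag d L f).trace = ∑ k, f k := by
  rw [conjDiag, Matrix.mul_assoc, trace_mul_comm, Matrix.mul_assoc, conjTranspose_sitePlaneWave_mul,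
    Matrix.mul_one, trace_diagonal]

/-- **Translation invariance**: every diagonal entry of `W diag(f) Wᴴ` is `L^{-d} Σ_k f(k)`
(`|W_{xk}|² = L^{-d}`). [cite: FriedliVelenikSMLS2017, §10.5.2] -/
theorem conjDiag_apply_self (f : FermionTorus d L → ℂ) (x : FermionTorus d L) :
    conjDiag d L f x x = ((L : ℂ) ^ d)⁻¹ * ∑ k, f k := by
  rw [conjDiag, Matrix.mul_apply, Finset.mul_sum]
  refine Finset.sum_congr rfl fun k _ => ?_
  rw [mul_diagonal, conjTranspose_apply]
  simp only [sitePlaneWave, Matrix.of_apply, star_mul', star_torusFourierWeight, Complex.star_def]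
  have h := torusChar_mul_conj k.toTorusSite x.toTorusSite
  calc torusFourierWeight d L * torusChar k.toTorusSite x.toTorusSite * f k *
        (torusFourierWeight d L * conj (torusChar k.toTorusSite x.toTorusSite))
      = (torusFourierWeight d L * torusFourierWeight d L) *
          (torusChar k.toTorusSite x.toTorusSite * conj (torusChar k.toTorusSite x.toTorusSite)) *
            f k := by ring
    _ = ((L : ℂ) ^ d)⁻¹ * f k := by rw [h, torusFourierWeight_mul_self, mul_one]

/-- `conjDiag f ≥ 0` for `f ≥ 0`. [folklore] -/
theorem posSemidef_conjDiag {f : FermionTorus d L → ℂ} (hf : ∀ k, 0 ≤ f k) :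
    (conjDiag d L f).PosSemidef :=
  (posSemidef_diagonal_iff.mpr hf).mul_mul_conjTranspose_same _

/-- The torus hopping matrix is `conjDiag` of its band (`L ≥ 3`).
[cite: FriedliVelenikSMLS2017, §10.5.2] -/
theorem hopMatrix_eq_conjDiag (hL : 3 ≤ L) (t : ℝ) :
    hopMatrix (fermionTorusGraph d L) t = conjDiag d L (fun k => ((siteBand t k : ℝ) : ℂ)) :=
  hopMatrix_torus_eq_conj hL t

omit [NeZero L] in
/-- `tr K = 0` (no self-loops). [folklore] -/
theorem trace_hopMatrix (t : ℝ) : (hopMatrix (fermionTorusGraph d L) t).trace = 0 := by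
  rw [Matrix.trace]
  refine Finset.sum_eq_zero fun x _ => ?_
  simp [hopMatrix]

end ConjDiag

/-! ### The staggering matrix and bipartiteness of the even torus -/

section Stagger

variable (d L) in
/-- The staggering matrix `S = diag((-1)^{Σ xᵢ})`. [cite: LangerMattis1971, eq. (2)] -/
def stagMatrix : Matrix (FermionTorus d L) (FermionTorus d L) ℂ :=
  diagonal fun x => (((torusStagger x : ℤˣ) : ℤ) : ℂ)

/-- `(-1)^{Σxᵢ} · (-1)^{Σxᵢ} = 1`. [folklore] -/
theorem stagger_mul_self (x : FermionTorus d L) :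
    ((((torusStagger x : ℤˣ) : ℤ) : ℂ)) * (((torusStagger x : ℤˣ) : ℤ) : ℂ) = 1 := by
  rw [← Int.cast_mul, ← Units.val_mul, ← sq, Int.units_sq, Units.val_one, Int.cast_one]

/-- `S² = 1`. [folklore] -/
theorem stagMatrix_mul_self : stagMatrix d L * stagMatrix d L = 1 := by
  rw [stagMatrix, diagonal_mul_diagonal, ← diagonal_one]
  congr 1
  funext x
  exact stagger_mul_self x

/-- `Sᴴ = S`. [folklore] -/
theorem conjTranspose_stagMatrix : (stagMatrix d L)ᴴ = stagMatrix d L := by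
  rw [stagMatrix, diagonal_conjTranspose]
  congr 1
  funext x
  simp

/-- **Bipartiteness of the even torus**: `K S = -S K`. [cite: LiebPRL1989, Theorem 2 (bipartite lattice)] -/
theorem hopMatrix_mul_stagMatrix (hL : Even L) (t : ℝ) :
    hopMatrix (fermionTorusGraph d L) t * stagMatrix d L =
      -(stagMatrix d L * hopMatrix (fermionTorusGraph d L) t) := by
  ext x y
  rw [stagMatrix, mul_diagonal, Matrix.neg_apply, diagonal_mul]
  simp only [hopMatrix, Matrix.of_apply]
  split_ifs with h
  · rw [torusStagger_eq_neg_of_adj_holds hL h, Units.val_neg, Int.cast_neg]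
    ring
  · simp

/-- `S K S = -K`. [folklore] -/
theorem stagMatrix_mul_hopMatrix_mul_stagMatrix (hL : Even L) (t : ℝ) :
    stagMatrix d L * hopMatrix (fermionTorusGraph d L) t * stagMatrix d L =
      -hopMatrix (fermionTorusGraph d L) t := by
  rw [Matrix.mul_assoc, hopMatrix_mul_stagMatrix hL, Matrix.mul_neg, ← Matrix.mul_assoc,
    stagMatrix_mul_self, Matrix.one_mul]

/-- `S K² S = K²`. [folklore] -/
theorem stagMatrix_mul_hopMatrix_sq_mul_stagMatrix (hL : Even L) (t : ℝ) :
    stagMatrix d L * (hopMatrix (fermionTorusGraph d L) t * hopMatrix (fermionTorusGraph d L) t) *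
        stagMatrix d L =
      hopMatrix (fermionTorusGraph d L) t * hopMatrix (fermionTorusGraph d L) t := by
  have h := stagMatrix_mul_hopMatrix_mul_stagMatrix (d := d) hL t
  calc stagMatrix d L * (hopMatrix (fermionTorusGraph d L) t * hopMatrix (fermionTorusGraph d L) t) *
        stagMatrix d L
      = (stagMatrix d L * hopMatrix (fermionTorusGraph d L) t * stagMatrix d L) *
          (stagMatrix d L * hopMatrix (fermionTorusGraph d L) t * stagMatrix d L) := by
        simp only [Matrix.mul_assoc]
        rw [← Matrix.mul_assoc (stagMatrix d L) (stagMatrix d L), stagMatrix_mul_self, Matrix.one_mul]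
    _ = _ := by rw [h, neg_mul_neg]

end Stagger

/-! ### The SDW resolvent `R = (K² + Δ²)^{-1/2}` and its symmetry under the staggering -/

section Resolvent

variable [NeZero L]

/-- The SDW band energy `E_k = √(ε_k² + Δ²)`, `ε_k = siteBand t k`. [cite: LangerMattis1971, eq. (3)] -/
def sdwE (t Δ : ℝ) (k : FermionTorus d L) : ℝ := Real.sqrt (siteBand t k ^ 2 + Δ ^ 2)

omit [NeZero L] in
/-- `E_k > 0` for `Δ ≠ 0`. [folklore] -/
theorem sdwE_pos (t : ℝ) {Δ : ℝ} (hΔ : Δ ≠ 0) (k : FermionTorus d L) : 0 < sdwE t Δ k :=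
  Real.sqrt_pos.mpr (by positivity)

omit [NeZero L] in
/-- `E_k² = ε_k² + Δ²`. [folklore] -/
theorem sdwE_sq (t Δ : ℝ) (k : FermionTorus d L) : sdwE t Δ k ^ 2 = siteBand t k ^ 2 + Δ ^ 2 :=
  Real.sq_sqrt (by positivity)

variable (d L) in
/-- The SDW resolvent `R = W diag(1/E_k) Wᴴ = (K² + Δ²)^{-1/2}`. [cite: LangerMattis1971, eq. (3)] -/
def sdwR (t Δ : ℝ) : Matrix (FermionTorus d L) (FermionTorus d L) ℂ :=
  conjDiag d L fun k => (((sdwE t Δ k)⁻¹ : ℝ) : ℂ)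

variable (d L) in
/-- `M = K² + Δ²`. [folklore] -/
def sdwM (t Δ : ℝ) : Matrix (FermionTorus d L) (FermionTorus d L) ℂ :=
  hopMatrix (fermionTorusGraph d L) t * hopMatrix (fermionTorusGraph d L) t + ((Δ ^ 2 : ℝ) : ℂ) • 1

/-- `K² + Δ² = W diag(E_k²) Wᴴ`. [folklore] -/
theorem sdwM_eq_conjDiag (hL : 3 ≤ L) (t Δ : ℝ) :
    sdwM d L t Δ = conjDiag d L (fun k => (((sdwE t Δ k) ^ 2 : ℝ) : ℂ)) := by
  rw [sdwM, hopMatrix_eq_conjDiag hL, conjDiag_mul, ← conjDiag_const, ← conjDiag_add]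
  congr 1
  funext k
  simp only [Pi.mul_apply, Pi.add_apply, sdwE_sq]
  push_cast
  ring

/-- `Rᴴ = R`. [folklore] -/
theorem conjTranspose_sdwR (t Δ : ℝ) : (sdwR d L t Δ)ᴴ = sdwR d L t Δ := by
  rw [sdwR, conjTranspose_conjDiag]
  congr 1
  funext k
  simp

/-- `R ≥ 0`. [folklore] -/
theorem posSemidef_sdwR (t Δ : ℝ) : (sdwR d L t Δ).PosSemidef :=
  posSemidef_conjDiag fun k => by
    exact_mod_cast inv_nonneg.mpr (Real.sqrt_nonneg _)

/-- `R² (K² + Δ²) = 1`. [folklore] -/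
theorem sdwR_mul_sdwR_mul_sdwM (hL : 3 ≤ L) (t : ℝ) {Δ : ℝ} (hΔ : Δ ≠ 0) :
    sdwR d L t Δ * sdwR d L t Δ * sdwM d L t Δ = 1 := by
  rw [sdwM_eq_conjDiag hL, sdwR, conjDiag_mul, conjDiag_mul, ← conjDiag_one]
  congr 1
  funext k
  have hE := (sdwE_pos t hΔ k).ne'
  simp only [Pi.mul_apply]
  push_cast
  field_simp

/-- `R K = K R`. [folklore] -/
theorem sdwR_mul_hopMatrix (hL : 3 ≤ L) (t Δ : ℝ) :
    sdwR d L t Δ * hopMatrix (fermionTorusGraph d L) t = hopMatrix (fermionTorusGraph d L) t * sdwR d L t Δ := by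
  rw [sdwR, hopMatrix_eq_conjDiag hL, conjDiag_mul, conjDiag_mul, mul_comm]

omit [NeZero L] in
/-- `S (K² + Δ²) S = K² + Δ²`. [folklore] -/
theorem stagMatrix_mul_sdwM_mul_stagMatrix (hLe : Even L) (t Δ : ℝ) :
    stagMatrix d L * sdwM d L t Δ * stagMatrix d L = sdwM d L t Δ := by
  rw [sdwM, Matrix.mul_add, Matrix.add_mul, stagMatrix_mul_hopMatrix_sq_mul_stagMatrix hLe,
    Matrix.mul_smul, Matrix.mul_one, Matrix.smul_mul, stagMatrix_mul_self]

omit [NeZero L] in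
/-- `S (K² + Δ²) = (K² + Δ²) S`. [folklore] -/
theorem stagMatrix_mul_sdwM (hLe : Even L) (t Δ : ℝ) :
    stagMatrix d L * sdwM d L t Δ = sdwM d L t Δ * stagMatrix d L := by
  calc stagMatrix d L * sdwM d L t Δ
      = stagMatrix d L * sdwM d L t Δ * (stagMatrix d L * stagMatrix d L) := by
        rw [stagMatrix_mul_self, Matrix.mul_one]
    _ = (stagMatrix d L * sdwM d L t Δ * stagMatrix d L) * stagMatrix d L := by
        simp only [Matrix.mul_assoc]
    _ = sdwM d L t Δ * stagMatrix d L := by rw [stagMatrix_mul_sdwM_mul_stagMatrix hLe]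

/-- `(S R S)² = R²` (both are `(K² + Δ²)⁻¹`). [folklore] -/
theorem stagMatrix_sdwR_sq (hL : 3 ≤ L) (hLe : Even L) (t : ℝ) {Δ : ℝ} (hΔ : Δ ≠ 0) :
    (stagMatrix d L * sdwR d L t Δ * stagMatrix d L) * (stagMatrix d L * sdwR d L t Δ * stagMatrix d L) =
      sdwR d L t Δ * sdwR d L t Δ := by
  have hSM := stagMatrix_mul_sdwM (d := d) hLe t Δ
  have hRRM := sdwR_mul_sdwR_mul_sdwM (d := d) hL t hΔ
  set S := stagMatrix d L with hS
  set R := sdwR d L t Δ with hR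
  set M := sdwM d L t Δ with hM
  have hSS : S * S = 1 := stagMatrix_mul_self
  have h1 : (S * R * S) * (S * R * S) = S * (R * R) * S := by
    calc (S * R * S) * (S * R * S) = S * R * (S * S) * R * S := by simp only [Matrix.mul_assoc]
      _ = S * (R * R) * S := by rw [hSS, Matrix.mul_one]; simp only [Matrix.mul_assoc]
  have h2 : S * (R * R) * S * M = 1 := by
    calc S * (R * R) * S * M = S * (R * R) * (S * M) := by simp only [Matrix.mul_assoc]
      _ = S * (R * R * M) * S := by rw [hSM]; simp only [Matrix.mul_assoc]
      _ = 1 := by rw [hRRM, Matrix.mul_one, hSS]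
  rw [h1, ← Matrix.inv_eq_left_inv h2, Matrix.inv_eq_left_inv hRRM]

/-- **`S R S = R`**: the SDW resolvent commutes with the staggering. Both `R` and `S R S` are
positive square roots of `(K² + Δ²)⁻¹`; uniqueness of the positive square root
(Mathlib `CFC.sqrt_unique`). [folklore] -/
theorem stagMatrix_mul_sdwR_mul_stagMatrix (hL : 3 ≤ L) (hLe : Even L) (t : ℝ) {Δ : ℝ} (hΔ : Δ ≠ 0) :
    stagMatrix d L * sdwR d L t Δ * stagMatrix d L = sdwR d L t Δ := by
  have hR : (sdwR d L t Δ).PosSemidef := posSemidef_sdwR t Δ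
  have hSRS : (stagMatrix d L * sdwR d L t Δ * stagMatrix d L).PosSemidef := by
    have h := hR.mul_mul_conjTranspose_same (stagMatrix d L)
    rwa [conjTranspose_stagMatrix] at h
  have e1 : CFC.sqrt (sdwR d L t Δ * sdwR d L t Δ) = sdwR d L t Δ := CFC.sqrt_unique rfl hR.nonneg
  have e2 : CFC.sqrt (sdwR d L t Δ * sdwR d L t Δ) = stagMatrix d L * sdwR d L t Δ * stagMatrix d L :=
    CFC.sqrt_unique (stagMatrix_sdwR_sq hL hLe t hΔ) hSRS.nonneg
  exact e2.symm.trans e1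

/-- `R S = S R`. [folklore] -/
theorem sdwR_mul_stagMatrix (hL : 3 ≤ L) (hLe : Even L) (t : ℝ) {Δ : ℝ} (hΔ : Δ ≠ 0) :
    sdwR d L t Δ * stagMatrix d L = stagMatrix d L * sdwR d L t Δ := by
  have h := stagMatrix_mul_sdwR_mul_stagMatrix (d := d) hL hLe t hΔ
  have hSS : stagMatrix d L * stagMatrix d L = 1 := stagMatrix_mul_self
  calc sdwR d L t Δ * stagMatrix d L
      = (stagMatrix d L * stagMatrix d L) * sdwR d L t Δ * stagMatrix d L := by rw [hSS, Matrix.one_mul]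
    _ = stagMatrix d L * (stagMatrix d L * sdwR d L t Δ * stagMatrix d L) := by
        simp only [Matrix.mul_assoc]
    _ = stagMatrix d L * sdwR d L t Δ := by rw [h]

/-- `tr (K R) = 0` (`S K S = -K`, `S R S = R`, cyclicity). [folklore] -/
theorem trace_hopMatrix_mul_sdwR (hL : 3 ≤ L) (hLe : Even L) (t : ℝ) {Δ : ℝ} (hΔ : Δ ≠ 0) :
    (hopMatrix (fermionTorusGraph d L) t * sdwR d L t Δ).trace = 0 := by
  have hRS := sdwR_mul_stagMatrix (d := d) hL hLe t hΔ
  have hSKS := stagMatrix_mul_hopMatrix_mul_stagMatrix (d := d) hLe t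
  set S := stagMatrix d L
  set K := hopMatrix (fermionTorusGraph d L) t
  set R := sdwR d L t Δ
  have hSS : S * S = 1 := stagMatrix_mul_self
  have hKR : S * (K * R) * S = -(K * R) := by
    calc S * (K * R) * S = S * K * (R * S) := by simp only [Matrix.mul_assoc]
      _ = (S * K * S) * R := by rw [hRS]; simp only [Matrix.mul_assoc]
      _ = -(K * R) := by rw [hSKS, neg_mul]
  have htr : (K * R).trace = -(K * R).trace := by
    calc (K * R).trace = (S * S * (K * R)).trace := by rw [hSS, Matrix.one_mul]
      _ = (S * (S * (K * R))).trace := by rw [Matrix.mul_assoc]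
      _ = (S * (K * R) * S).trace := by rw [trace_mul_comm]
      _ = -(K * R).trace := by rw [hKR, trace_neg]
  have h2 : (2 : ℂ) * (K * R).trace = 0 := by linear_combination htr
  exact (mul_eq_zero.mp h2).resolve_left two_ne_zero

/-- `(K R)_{xx} = 0` for every site. [folklore] -/
theorem hopMatrix_mul_sdwR_apply_self (hL : 3 ≤ L) (hLe : Even L) (t : ℝ) {Δ : ℝ} (hΔ : Δ ≠ 0)
    (x : FermionTorus d L) : (hopMatrix (fermionTorusGraph d L) t * sdwR d L t Δ) x x = 0 := by
  have h0 := trace_hopMatrix_mul_sdwR (d := d) hL hLe t hΔ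
  rw [hopMatrix_eq_conjDiag hL, sdwR, conjDiag_mul, trace_conjDiag] at h0
  rw [hopMatrix_eq_conjDiag hL, sdwR, conjDiag_mul, conjDiag_apply_self, h0, mul_zero]

/-- `R_{xx} = L^{-d} Σ_k E_k⁻¹`. [folklore] -/
theorem sdwR_apply_self (t Δ : ℝ) (x : FermionTorus d L) :
    sdwR d L t Δ x x = ((L : ℂ) ^ d)⁻¹ * ∑ k : FermionTorus d L, (((sdwE t Δ k)⁻¹ : ℝ) : ℂ) :=
  conjDiag_apply_self _ x

/-- `tr (K² R) = Σ_k ε_k² / E_k`. [folklore] -/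
theorem trace_hopMatrix_sq_mul_sdwR (hL : 3 ≤ L) (t Δ : ℝ) :
    (hopMatrix (fermionTorusGraph d L) t * hopMatrix (fermionTorusGraph d L) t * sdwR d L t Δ).trace =
      ∑ k : FermionTorus d L, (((siteBand t k ^ 2 * (sdwE t Δ k)⁻¹ : ℝ)) : ℂ) := by
  rw [hopMatrix_eq_conjDiag hL, sdwR, conjDiag_mul, conjDiag_mul, trace_conjDiag]
  refine Finset.sum_congr rfl fun k _ => ?_
  simp only [Pi.mul_apply]
  push_cast
  ring

end Resolvent

/-! ### The SDW one-body Hamiltonians `h_s = K + sΔ S` and the band projections -/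

section Projection

variable [NeZero L]

variable (d L) in
/-- `h_s = K + sΔ S` (`s = ±1`: the two spin species see opposite staggered fields).
[cite: LangerMattis1971, eq. (2)] -/
def sdwH (t Δ s : ℝ) : Matrix (FermionTorus d L) (FermionTorus d L) ℂ :=
  hopMatrix (fermionTorusGraph d L) t + ((s * Δ : ℝ) : ℂ) • stagMatrix d L

omit [NeZero L] in
/-- `h_sᴴ = h_s`. [folklore] -/
theorem conjTranspose_sdwH (t Δ s : ℝ) : (sdwH d L t Δ s)ᴴ = sdwH d L t Δ s := by
  rw [sdwH, conjTranspose_add, conjTranspose_smul, (isHermitian_hopMatrix _ t).eq, conjTranspose_stagMatrix]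
  simp

/-- `h_s R = R h_s`. [folklore] -/
theorem sdwH_mul_sdwR (hL : 3 ≤ L) (hLe : Even L) (t : ℝ) {Δ : ℝ} (hΔ : Δ ≠ 0) (s : ℝ) :
    sdwH d L t Δ s * sdwR d L t Δ = sdwR d L t Δ * sdwH d L t Δ s := by
  rw [sdwH, Matrix.add_mul, Matrix.mul_add, Matrix.smul_mul, Matrix.mul_smul, ← sdwR_mul_hopMatrix hL,
    sdwR_mul_stagMatrix hL hLe t hΔ]

omit [NeZero L] in
/-- `h_s² = K² + Δ²` for `s² = 1` (`K S + S K = 0`). [cite: LangerMattis1971, eq. (3)] -/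
theorem sdwH_mul_sdwH (hLe : Even L) (t Δ : ℝ) {s : ℝ} (hs : s * s = 1) :
    sdwH d L t Δ s * sdwH d L t Δ s = sdwM d L t Δ := by
  rw [sdwH, sdwM, Matrix.add_mul, Matrix.mul_add, Matrix.mul_add, Matrix.smul_mul, Matrix.mul_smul,
    Matrix.smul_mul, Matrix.mul_smul, hopMatrix_mul_stagMatrix hLe, stagMatrix_mul_self, smul_smul]
  have hs' : (s : ℂ) * s = 1 := by exact_mod_cast hs
  have hc : ((s * Δ : ℝ) : ℂ) * ((s * Δ : ℝ) : ℂ) = ((Δ ^ 2 : ℝ) : ℂ) := by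
    push_cast
    linear_combination (Δ : ℂ) ^ 2 * hs'
  rw [hc, smul_neg]
  abel

/-- `(h_s R)² = 1`. [folklore] -/
theorem sdwH_mul_sdwR_sq (hL : 3 ≤ L) (hLe : Even L) (t : ℝ) {Δ : ℝ} (hΔ : Δ ≠ 0) {s : ℝ}
    (hs : s * s = 1) :
    (sdwH d L t Δ s * sdwR d L t Δ) * (sdwH d L t Δ s * sdwR d L t Δ) = 1 := by
  have h1 : sdwM d L t Δ * (sdwR d L t Δ * sdwR d L t Δ) = 1 :=
    mul_eq_one_comm.mp (sdwR_mul_sdwR_mul_sdwM hL t hΔ)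
  calc (sdwH d L t Δ s * sdwR d L t Δ) * (sdwH d L t Δ s * sdwR d L t Δ)
      = sdwH d L t Δ s * (sdwR d L t Δ * sdwH d L t Δ s) * sdwR d L t Δ := by
        simp only [Matrix.mul_assoc]
    _ = (sdwH d L t Δ s * sdwH d L t Δ s) * (sdwR d L t Δ * sdwR d L t Δ) := by
        rw [← sdwH_mul_sdwR hL hLe t hΔ s]; simp only [Matrix.mul_assoc]
    _ = 1 := by rw [sdwH_mul_sdwH hLe t Δ hs, h1]

variable (d L) in
/-- The SDW band projection `P_s = ½(1 - h_s R)` (lower band of `h_s` filled).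
[cite: LangerMattis1971, eq. (2)] -/
def sdwProj (t Δ s : ℝ) : Matrix (FermionTorus d L) (FermionTorus d L) ℂ :=
  (1 / 2 : ℂ) • (1 - sdwH d L t Δ s * sdwR d L t Δ)

/-- `P_sᴴ = P_s`. [folklore] -/
theorem conjTranspose_sdwProj (hL : 3 ≤ L) (hLe : Even L) (t : ℝ) {Δ : ℝ} (hΔ : Δ ≠ 0) (s : ℝ) :
    (sdwProj d L t Δ s)ᴴ = sdwProj d L t Δ s := by
  rw [sdwProj, conjTranspose_smul, conjTranspose_sub, conjTranspose_one, conjTranspose_mul,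
    conjTranspose_sdwR, conjTranspose_sdwH, ← sdwH_mul_sdwR hL hLe t hΔ s]
  congr 1
  simp

/-- `P_s² = P_s`. [folklore] -/
theorem sdwProj_mul_self (hL : 3 ≤ L) (hLe : Even L) (t : ℝ) {Δ : ℝ} (hΔ : Δ ≠ 0) {s : ℝ}
    (hs : s * s = 1) : sdwProj d L t Δ s * sdwProj d L t Δ s = sdwProj d L t Δ s := by
  have hX := sdwH_mul_sdwR_sq (d := d) hL hLe t hΔ hs
  rw [sdwProj]
  set X := sdwH d L t Δ s * sdwR d L t Δ
  rw [smul_mul_smul, sub_mul, mul_sub, mul_sub, Matrix.one_mul, Matrix.mul_one,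
    Matrix.one_mul, hX]
  have h : (1 : Matrix (FermionTorus d L) (FermionTorus d L) ℂ) - X - (X - 1) = (2 : ℂ) • (1 - X) := by
    rw [two_smul]; abel
  rw [h, smul_smul]
  norm_num

/-- Diagonal of the band projection: `P_s(x,x) = ½(1 - sΔ(-1)^x r)`, `r = L^{-d} Σ_k E_k⁻¹`.
[cite: LangerMattis1971, eq. (2)] -/
theorem sdwProj_apply_self (hL : 3 ≤ L) (hLe : Even L) (t : ℝ) {Δ : ℝ} (hΔ : Δ ≠ 0) (s : ℝ)
    (x : FermionTorus d L) :
    sdwProj d L t Δ s x x = (1 / 2 : ℂ) * (1 - ((s * Δ : ℝ) : ℂ) *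
      ((((torusStagger x : ℤˣ) : ℤ) : ℂ) * (((L : ℂ) ^ d)⁻¹ * ∑ k : FermionTorus d L, (((sdwE t Δ k)⁻¹ : ℝ) : ℂ)))) := by
  rw [sdwProj, Matrix.smul_apply, smul_eq_mul, Matrix.sub_apply, Matrix.one_apply_eq, sdwH,
    Matrix.add_mul, Matrix.add_apply, hopMatrix_mul_sdwR_apply_self hL hLe t hΔ, zero_add,
    Matrix.smul_mul, Matrix.smul_apply, smul_eq_mul, stagMatrix, diagonal_mul, sdwR_apply_self]

/-- `tr P_+ + tr P_- = L^d` (the `S`-terms cancel; `tr (K R) = 0`). [folklore] -/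
theorem trace_sdwProj_add (hL : 3 ≤ L) (hLe : Even L) (t : ℝ) {Δ : ℝ} (hΔ : Δ ≠ 0) :
    (sdwProj d L t Δ 1).trace + (sdwProj d L t Δ (-1)).trace = (L : ℂ) ^ d := by
  have hK := trace_hopMatrix_mul_sdwR (d := d) hL hLe t hΔ
  have hcard : ((1 : Matrix (FermionTorus d L) (FermionTorus d L) ℂ)).trace = (L : ℂ) ^ d := by
    rw [trace_one, card_fermionTorus_eq]; push_cast; rfl
  simp only [sdwProj, sdwH, trace_smul, trace_sub, Matrix.add_mul, trace_add, Matrix.smul_mul,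
    hK, hcard, smul_eq_mul]
  push_cast
  ring

end Projection

/-! ### Spin-block-diagonal one-particle matrices on `Orb Λ` -/

section SpinBlock

variable {Λ : Type*} [LinearOrder Λ] [Fintype Λ]

/-- The spin-diagonal lift of a pair of site matrices (`P 0 = P↑`, `P 1 = P↓`) to the orbital space
`Orb Λ = Λ ×ₗ Fin 2`: `P((x,σ),(y,τ)) = [σ = τ] P_σ(x,y)` (collinear Hartree–Fock states).
[cite: BachLiebSolovej1994, eq. (3a.2)] -/
def spinBlock (P : Fin 2 → Matrix Λ Λ ℂ) : Matrix (Orb Λ) (Orb Λ) ℂ :=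
  Matrix.of fun o o' => if (ofLex o).2 = (ofLex o').2 then P (ofLex o).2 (ofLex o).1 (ofLex o').1 else 0

omit [LinearOrder Λ] [Fintype Λ] in
/-- Entries of `spinBlock` at orbitals. [folklore] -/
@[simp] theorem spinBlock_orb (P : Fin 2 → Matrix Λ Λ ℂ) (x y : Λ) (σ τ : Fin 2) :
    spinBlock P (orb x σ) (orb y τ) = if σ = τ then P σ x y else 0 := by
  simp [spinBlock, orb]

omit [LinearOrder Λ] [Fintype Λ] in
/-- Every orbital is some `(x, σ)`. [folklore] -/
theorem exists_eq_orb (o : Orb Λ) : ∃ x σ, o = orb x σ :=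
  ⟨(ofLex o).1, (ofLex o).2, by simp [orb]⟩

omit [LinearOrder Λ] [Fintype Λ] in
/-- `(spinBlock P)ᴴ = spinBlock (Pᴴ)`. [folklore] -/
theorem conjTranspose_spinBlock (P : Fin 2 → Matrix Λ Λ ℂ) :
    (spinBlock P)ᴴ = spinBlock fun σ => (P σ)ᴴ := by
  ext o o'
  obtain ⟨x, σ, rfl⟩ := exists_eq_orb o
  obtain ⟨y, τ, rfl⟩ := exists_eq_orb o'
  rw [conjTranspose_apply, spinBlock_orb, spinBlock_orb]
  by_cases h : σ = τ
  · subst h; simp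
  · rw [if_neg h, if_neg (Ne.symm h), star_zero]

omit [LinearOrder Λ] in
/-- `spinBlock P · spinBlock Q = spinBlock (P Q)`. [folklore] -/
theorem spinBlock_mul_spinBlock (P Q : Fin 2 → Matrix Λ Λ ℂ) :
    spinBlock P * spinBlock Q = spinBlock fun σ => P σ * Q σ := by
  ext o o'
  obtain ⟨x, σ, rfl⟩ := exists_eq_orb o
  obtain ⟨y, τ, rfl⟩ := exists_eq_orb o'
  have hinner : ∀ z : Λ,
      ∑ ρ : Fin 2, spinBlock P (orb x σ) (orb z ρ) * spinBlock Q (orb z ρ) (orb y τ) =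
        if σ = τ then P σ x z * Q σ z y else 0 := by
    intro z
    fin_cases σ <;> fin_cases τ <;> simp
  rw [Matrix.mul_apply, sum_orb_eq_sum_sum, spinBlock_orb]
  simp only [hinner]
  by_cases h : σ = τ
  · subst h
    rw [if_pos rfl, Matrix.mul_apply]
    exact Finset.sum_congr rfl fun z _ => if_pos rfl
  · rw [if_neg h]
    exact Finset.sum_eq_zero fun z _ => if_neg h

omit [LinearOrder Λ] in
/-- `tr (spinBlock P) = tr P↑ + tr P↓`. [folklore] -/
theorem trace_spinBlock (P : Fin 2 → Matrix Λ Λ ℂ) :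
    (spinBlock P).trace = ∑ σ, (P σ).trace := by
  simp only [Matrix.trace, Matrix.diag_apply]
  rw [sum_orb_eq_sum_sum, Finset.sum_comm]
  simp

omit [LinearOrder Λ] in
/-- **The Hartree–Fock functional of a collinear (spin-block-diagonal) state**: kinetic term
`Σ_σ tr (K_{-t} P_σ)` (`K_{-t} = hopMatrix G (-t)`, the one-body hopping matrix of `H(t,U)`) plus
the direct term `U Σ_x P↑(x,x) P↓(x,x)`; the exchange term vanishes.
[cite: BachLiebSolovej1994, eq. (2c.8)] -/
theorem hfEnergy_spinBlock (G : SimpleGraph Λ) [DecidableRel G.Adj] (t U : ℝ)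
    (P : Fin 2 → Matrix Λ Λ ℂ) :
    hfEnergy G t U (spinBlock P) =
      ∑ σ, (hopMatrix G (-t) * P σ).trace + (U : ℂ) * ∑ x, P 0 x x * P 1 x x := by
  have hkin : ∀ σ : Fin 2, (hopMatrix G (-t) * P σ).trace =
      ∑ x, ∑ y, (if G.Adj x y then -(t : ℂ) * P σ y x else 0) := by
    intro σ
    simp only [Matrix.trace, Matrix.diag_apply, Matrix.mul_apply, hopMatrix, Matrix.of_apply,
      ite_mul, zero_mul, Complex.ofReal_neg]
  have h01 : ((1 : Fin 2) = 0) = False := by decide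
  have h10 : ((0 : Fin 2) = 1) = False := by decide
  rw [hfEnergy]
  simp only [spinBlock_orb, if_true, h01, h10, if_false, zero_mul, sub_zero, hkin]
  congr 1
  rw [Finset.mul_sum]
  have hswap : ∀ x : Λ, (-(t : ℂ)) * ∑ y, ∑ σ : Fin 2, (if G.Adj x y then P σ y x else 0) =
      ∑ σ : Fin 2, ∑ y, (if G.Adj x y then -(t : ℂ) * P σ y x else 0) := by
    intro x
    rw [Finset.mul_sum, Finset.sum_comm]
    refine Finset.sum_congr rfl fun σ _ => ?_
    rw [Finset.mul_sum]
    refine Finset.sum_congr rfl fun y _ => ?_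
    split_ifs <;> simp
  simp only [hswap]
  rw [Finset.sum_comm]

end SpinBlock

/-! ### The SDW state of the Hubbard torus and its Hartree–Fock energy -/

section SDWState

variable [NeZero L]

/-- The spin sign `s(↑) = 1`, `s(↓) = -1`. [folklore] -/
def sdwSpin (σ : Fin 2) : ℝ := if σ = 0 then 1 else -1

omit [NeZero L] in
/-- `s(↑) = 1`. [folklore] -/
@[simp] theorem sdwSpin_zero : sdwSpin 0 = 1 := rfl

omit [NeZero L] in
/-- `s(↓) = -1`. [folklore] -/
@[simp] theorem sdwSpin_one : sdwSpin 1 = -1 := rfl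

omit [NeZero L] in
/-- `s(σ)² = 1`. [folklore] -/
theorem sdwSpin_mul_self (σ : Fin 2) : sdwSpin σ * sdwSpin σ = 1 := by
  fin_cases σ <;> simp [sdwSpin]

variable (d L) in
/-- The antiferromagnetic Hartree–Fock (SDW) one-particle density matrix of the Hubbard torus
`H(t,U)`: spin `σ` fills the lower band of `K_{-t} + s(σ)Δ S`. [cite: LangerMattis1971, eq. (2)] -/
def sdwState (t Δ : ℝ) : Matrix (Orb (FermionTorus d L)) (Orb (FermionTorus d L)) ℂ :=
  spinBlock fun σ => sdwProj d L (-t) Δ (sdwSpin σ)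

/-- The SDW density matrix is Hermitian. [folklore] -/
theorem isHermitian_sdwState (hL : 3 ≤ L) (hLe : Even L) (t : ℝ) {Δ : ℝ} (hΔ : Δ ≠ 0) :
    (sdwState d L t Δ).IsHermitian := by
  rw [Matrix.IsHermitian, sdwState, conjTranspose_spinBlock]
  congr 1
  funext σ
  exact conjTranspose_sdwProj hL hLe (-t) hΔ _

/-- The SDW density matrix is a projection. [folklore] -/
theorem sdwState_mul_self (hL : 3 ≤ L) (hLe : Even L) (t : ℝ) {Δ : ℝ} (hΔ : Δ ≠ 0) :
    sdwState d L t Δ * sdwState d L t Δ = sdwState d L t Δ := by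
  rw [sdwState, spinBlock_mul_spinBlock]
  congr 1
  funext σ
  exact sdwProj_mul_self hL hLe (-t) hΔ (sdwSpin_mul_self σ)

/-- The SDW state has `L^d` particles (half filling). [folklore] -/
theorem trace_sdwState (hL : 3 ≤ L) (hLe : Even L) (t : ℝ) {Δ : ℝ} (hΔ : Δ ≠ 0) :
    (sdwState d L t Δ).trace = ((L ^ d : ℕ) : ℂ) := by
  rw [sdwState, trace_spinBlock, Fin.sum_univ_two, sdwSpin_zero, sdwSpin_one,
    trace_sdwProj_add hL hLe (-t) hΔ]
  push_cast
  rfl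

/-- **The Hartree–Fock energy of the SDW state** in closed momentum-sum form:
`E_HF = -Σ_k ε_k²/E_k + (U/4)(L^d - Δ² (Σ_k E_k⁻¹)² / L^d)`, `E_k = √(ε_k² + Δ²)`.
[cite: LangerMattis1971, eq. (4)] -/
theorem hfEnergy_sdwState (hL : 3 ≤ L) (hLe : Even L) (t U : ℝ) {Δ : ℝ} (hΔ : Δ ≠ 0) :
    hfEnergy (fermionTorusGraph d L) t U (sdwState d L t Δ) =
      ((-(∑ k : FermionTorus d L, siteBand (-t) k ^ 2 * (sdwE (-t) Δ k)⁻¹) +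
          U / 4 * ((L : ℝ) ^ d - Δ ^ 2 * (∑ k : FermionTorus d L, (sdwE (-t) Δ k)⁻¹) ^ 2 /
            (L : ℝ) ^ d) : ℝ) : ℂ) := by
  set K := hopMatrix (fermionTorusGraph d L) (-t) with hK
  set R := sdwR d L (-t) Δ with hR
  set S := stagMatrix d L with hS
  have hKtr : K.trace = 0 := trace_hopMatrix (-t)
  have hKKR := trace_hopMatrix_sq_mul_sdwR (d := d) hL (-t) Δ
  have hdiag := fun s => sdwProj_apply_self (d := d) hL hLe (-t) hΔ s
  have hLd : ((L : ℂ) ^ d) ≠ 0 := pow_ne_zero _ (Nat.cast_ne_zero.mpr (NeZero.ne L))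
  -- kinetic part
  have hkin : ∑ σ : Fin 2, (K * sdwProj d L (-t) Δ (sdwSpin σ)).trace =
      -(K * K * R).trace := by
    have hone : ∀ s : ℝ, (K * sdwProj d L (-t) Δ s).trace =
        (1 / 2 : ℂ) * (-(K * K * R).trace - ((s * Δ : ℝ) : ℂ) * (K * S * R).trace) := by
      intro s
      rw [sdwProj, Matrix.mul_smul, trace_smul, smul_eq_mul, Matrix.mul_sub, Matrix.mul_one,
        trace_sub, hKtr, sdwH, Matrix.add_mul, Matrix.mul_add, trace_add, Matrix.smul_mul,
        Matrix.mul_smul, trace_smul, smul_eq_mul, ← Matrix.mul_assoc, ← Matrix.mul_assoc]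
      ring
    rw [Fin.sum_univ_two, hone, hone, sdwSpin_zero, sdwSpin_one]
    push_cast
    ring
  -- interaction part
  have hint : ∑ x : FermionTorus d L,
      sdwProj d L (-t) Δ (sdwSpin 0) x x * sdwProj d L (-t) Δ (sdwSpin 1) x x =
      (L : ℂ) ^ d * ((1 / 4 : ℂ) * (1 - ((Δ ^ 2 : ℝ) : ℂ) *
        (((L : ℂ) ^ d)⁻¹ * ∑ k : FermionTorus d L, (((sdwE (-t) Δ k)⁻¹ : ℝ) : ℂ)) ^ 2)) := by
    have hx : ∀ x : FermionTorus d L,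
        sdwProj d L (-t) Δ (sdwSpin 0) x x * sdwProj d L (-t) Δ (sdwSpin 1) x x =
        (1 / 4 : ℂ) * (1 - ((Δ ^ 2 : ℝ) : ℂ) *
          (((L : ℂ) ^ d)⁻¹ * ∑ k : FermionTorus d L, (((sdwE (-t) Δ k)⁻¹ : ℝ) : ℂ)) ^ 2) := by
      intro x
      rw [hdiag, hdiag, sdwSpin_zero, sdwSpin_one]
      have hs := stagger_mul_self x
      set r := ((L : ℂ) ^ d)⁻¹ * ∑ k : FermionTorus d L, (((sdwE (-t) Δ k)⁻¹ : ℝ) : ℂ) with hr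
      set sx := (((torusStagger x : ℤˣ) : ℤ) : ℂ) with hsx
      push_cast
      linear_combination (-(1 / 4 : ℂ)) * (Δ : ℂ) ^ 2 * r ^ 2 * hs
    simp only [hx, Finset.sum_const, Finset.card_univ, card_fermionTorus_eq, nsmul_eq_mul]
    push_cast
    ring
  rw [sdwState, hfEnergy_spinBlock, hkin, hint, hKKR]
  push_cast
  field_simp

/-- **Antiferromagnetic Hartree–Fock upper bound on the even torus.** For `L` even, `L ≥ 3`, all
real `t, U` and every gap parameter `Δ ≠ 0`:
`E_L(L^d) ≤ -Σ_k ε_k²/E_k + (U/4)(L^d - Δ²(Σ_k E_k⁻¹)²/L^d)`, with `ε_k = 2tΣᵢcos(2πkᵢ/L)`,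
`E_k = √(ε_k² + Δ²)`, sums over `k ∈ (ℤ/Lℤ)^d` — the energy of the spin-density-wave Slater
determinant (Langer–Mattis eqs. (2)–(4); at the self-consistent `Δ` it is their `E_A(U,x*)`),
by the Hartree–Fock variational bound of Bach–Lieb–Solovej (2c.36).
[cite: LangerMattis1971, eq. (4)][cite: BachLiebSolovej1994, eq. (2c.36)] -/
theorem hubbardTorus_groundEnergyAt_le_sdw (hLe : Even L) (hL : 3 ≤ L) (t U : ℝ) {Δ : ℝ}
    (hΔ : Δ ≠ 0) :
    groundEnergyAt (fermionTorusGraph d L) t U (L ^ d) ≤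
      -(∑ k : FermionTorus d L, siteBand (-t) k ^ 2 * (sdwE (-t) Δ k)⁻¹) +
        U / 4 * ((L : ℝ) ^ d - Δ ^ 2 * (∑ k : FermionTorus d L, (sdwE (-t) Δ k)⁻¹) ^ 2 /
          (L : ℝ) ^ d) := by
  have h := groundEnergyAt_le_hfEnergy (fermionTorusGraph d L) t U
    (isHermitian_sdwState hL hLe t hΔ) (sdwState_mul_self hL hLe t hΔ) (trace_sdwState hL hLe t hΔ)
  rwa [hfEnergy_sdwState hL hLe t U hΔ, Complex.ofReal_re] at h

/-- The SDW band energy in the momentum variable, `E(p) = √((2tΣᵢcos pᵢ)² + Δ²)` at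
`p = 2πk/L`. [cite: LangerMattis1971, eq. (3)] -/
theorem sdwE_ofTorusSite (t Δ : ℝ) (z : TorusSite d L) :
    sdwE (-t) Δ (FermionTorus.ofTorusSite z) =
      Real.sqrt ((t * (2 * ∑ i, Real.cos (latticeMomentum L z i))) ^ 2 + Δ ^ 2) := by
  simp only [sdwE, siteBand, FermionTorus.toTorusSite_ofTorusSite, neg_mul, neg_sq]

/-- `ε_k²` in the momentum variable. [folklore] -/
theorem siteBand_neg_sq_ofTorusSite (t : ℝ) (z : TorusSite d L) :
    siteBand (-t) (FermionTorus.ofTorusSite z) ^ 2 = (t * (2 * ∑ i, Real.cos (latticeMomentum L z i))) ^ 2 := by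
  simp only [siteBand, FermionTorus.toTorusSite_ofTorusSite, neg_mul, neg_sq]

/-- **Antiferromagnetic Hartree–Fock upper bound, momentum form**: for `L` even, `L ≥ 3`, all real
`t, U`, `Δ ≠ 0`,
`E_L(L^d) ≤ -Σ_{k∈(ℤ/L)^d} ε_k²/√(ε_k²+Δ²) + (U/4)(L^d - Δ²(Σ_k 1/√(ε_k²+Δ²))²/L^d)`,
`ε_k = 2tΣᵢcos(2πkᵢ/L)`. [cite: LangerMattis1971, eq. (4)][cite: BachLiebSolovej1994, eq. (2c.36)] -/
theorem hubbardTorus_groundEnergyAt_le_sdw_momentum (hLe : Even L) (hL : 3 ≤ L) (t U : ℝ) {Δ : ℝ}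
    (hΔ : Δ ≠ 0) :
    groundEnergyAt (fermionTorusGraph d L) t U (L ^ d) ≤
      -(∑ k : TorusSite d L, (t * (2 * ∑ i, Real.cos (latticeMomentum L k i))) ^ 2 *
          (Real.sqrt ((t * (2 * ∑ i, Real.cos (latticeMomentum L k i))) ^ 2 + Δ ^ 2))⁻¹) +
        U / 4 * ((L : ℝ) ^ d - Δ ^ 2 *
          (∑ k : TorusSite d L, (Real.sqrt ((t * (2 * ∑ i, Real.cos (latticeMomentum L k i))) ^ 2 + Δ ^ 2))⁻¹) ^ 2 /
            (L : ℝ) ^ d) := by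
  have h := hubbardTorus_groundEnergyAt_le_sdw (d := d) hLe hL t U hΔ
  rw [FermionTorus.sum_eq_sum_torusSite, FermionTorus.sum_eq_sum_torusSite] at h
  simp only [sdwE_ofTorusSite, siteBand_neg_sq_ofTorusSite] at h
  exact h

end SDWState

end HartreeFock

end Literature.MathematicalPhysics.QuantumLattice
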